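import Literature.NumberTheory.Sieve.LinearEquationsInPrimesGowersCyclic
import HarnessLib

/-!
# The reduced generalised von Neumann theorem, core form (Green–Tao 2010, App. C)

Trunk T-SIEVE (`Literature/NumberTheory/Sieve`). Third file of the App. B/C layer of the
decomposition of `Literature.NumberTheory.Sieve.GreenTaoZiegler2012_finiteComplexity`, towards the discharge of the
named fact `Literature.NumberTheory.Sieve.GreenTao2010_generalisedVonNeumann` (Prop. 7.1). B. Green, T. Tao, *Linear
equations in primes*, Ann. of Math. 171 (2010), App. C, "Main argument": after permuting the
basis, the distinguished form is `ψ₁(x₁,…,x_{s+1},y) = ∑ a_j x_j + ψ₁(0,y)` with all `a_j ≠ 0`,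
every other form misses one of the private variables `x_j`, the forms are grouped by the set
`Ω(i) ⊆ [s+1]` of private variables they involve, the weighted generalised von Neumann inequality
(Cor. B.4) is applied, and the top term is evaluated by the substitution
`h := x⁽¹⁾ - x⁽⁰⁾`, `z := ∑ a_j x_j⁽⁰⁾ + ψ₁(0,y)` and a final Cauchy–Schwarz against the weight
`W(z,h)` (the proof of the top-term estimate, the first of the two displays following "Applying
Hölder's inequality … it suffices to show that"). This file proves that skeleton with the lower-order functions
left abstract (families `f_B, ν_B`, `B ⊆ A`, as in Cor. B.4) and **without dilating the private
variables** (we keep the unit coefficients `a_j` instead of normalising them to `1`, and use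
`h_j ↦ a_j h_j`):

* `Literature.NumberTheory.Sieve.SplitIdx`, `Literature.NumberTheory.Sieve.privSet`, `Literature.NumberTheory.Sieve.topForm` — split coordinates `(x, y) ∈ ℤ_{N'}^k × ℤ_{N'}^{d'}`,
  the doubled (private) coordinate set `A`, the distinguished form `θ₀ = b₀(y) + ∑ a_j x_j`;
* `Literature.NumberTheory.Sieve.topParam`, `Literature.NumberTheory.Sieve.topParamEquiv`, `Literature.NumberTheory.Sieve.expect_pairs_eq_expect_topParam` — the change of
  variables `(x⁽⁰⁾, y⁰, x⁽¹⁾, y¹) ↔ (z, h, r)` with fibre coordinates `r` (an explicit bijection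
  once the discarded pivot coordinate is remembered), and `θ₀(x^{(ω)}) = z + ∑_{j∈ω} a_j h_j`
  (`Literature.NumberTheory.Sieve.topForm_mixPt_topParam`);
* `Literature.NumberTheory.Sieve.topA₀`, `Literature.NumberTheory.Sieve.topA₁`, `Literature.NumberTheory.Sieve.topA₂` — the three averages "for `n = 0, 1, 2`" of App. C
  written over free variables (`A₂` over two independent copies of the fibre coordinates, the
  sextuple average `𝔼_*`), so that `𝔼 V (W - 1)² = A₂ - 2A₁ + A₀`;
* `Literature.NumberTheory.Sieve.wBoxPower_top_le` — `‖g₀ ∘ θ₀‖_{□^A(ν)}^{2^k} ≤ ‖g₀‖_{U^k(ℤ_{N'})}^{2^k} + (A₀|A₂ - 2A₁ + A₀|)^{1/2}`;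
* `Literature.NumberTheory.Sieve.coreGvN` — with Cor. B.4:
  `|𝔼 ∏_{B ⊆ A} f_B|^{2^k} ≤ (‖g₀‖_{U^k}^{2^k} + (A₀|A₂ - 2A₁ + A₀|)^{1/2}) ∏_{B ⊊ A} ‖ν_B‖_{□^B(ν)}^{2^{|B|}}`.

The averages `A₀, A₁, A₂, ‖ν_B‖_{□^B(ν)}` are products of the majorant along explicit systems of
affine forms in free variables; that they are `1 + o(1)` under the linear forms condition
(the lower-weight estimate, and the finite-complexity verification for the sextuple average and
its "slightly alarming expression") is the business of the next file.

## References

* B. Green, T. Tao, *Linear equations in primes*, Ann. of Math. (2) 171 (2010), 1753–1850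
  (arXiv:math/0606088), App. C: Proposition 7.1″ (reduced generalised von Neumann theorem),
  the two estimates following "Applying Hölder's inequality" (top term, lower weights), the
  substitution `h := x⁽¹⁾ - x⁽⁰⁾, z := …`, the weight `W(z,h)`, "By Cauchy–Schwarz and the
  hypothesis `|f₁(x)| ≤ ν(x)`", the sextuple average `𝔼_*`.
-/

noncomputable section

open Finset
open scoped BigOperators

namespace Literature.NumberTheory.Sieve

/-! ### The top term of the reduced generalised von Neumann theorem (Green–Tao 2010, App. C) -/

section topterm

variable {N' : ℕ} [NeZero N'] {k d' : ℕ}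

/-- Index type of the variables in split coordinates: `k` private coordinates `x` (on which the
distinguished form depends with unit coefficients) and `d'` further coordinates `y`.
[cite: GreenTao2010, App. C (Main argument: "writing `n = (x₁,…,x_{s+1},y)`")] -/
abbrev SplitIdx (k d' : ℕ) := Fin k ⊕ Fin d'

/-- The doubled coordinates: the private ones. [cite: GreenTao2010, App. C (Main argument)] -/
def privSet (k d' : ℕ) : Finset (SplitIdx k d') :=
  Finset.univ.map ⟨Sum.inl, Sum.inl_injective⟩

/-- The distinguished form `θ₀(x, y) = b₀(y) + ∑_j a_j x_j` in split coordinates (`ψ₁` of App. C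
after permuting the basis; `b₀(y) = ψ₁(0, y)`). [cite: GreenTao2010, App. C (Main argument)] -/
def topForm (a : Fin k → ZMod N') (b₀ : (Fin d' → ZMod N') → ZMod N') (p : SplitIdx k d' → ZMod N') :
    ZMod N' :=
  b₀ (fun m => p (Sum.inr m)) + ∑ j, a j * p (Sum.inl j)

/-- The lower-order weight `∏_{C ⊊ A} ∏_{ω ⊆ C} ν_C(x^{(ω)})` of the weighted box norm over the
private coordinates `A`. [cite: GreenTao2010, App. B, Cor. B.4 and App. C (the weight `W`)] -/
def topWeight (ν : Finset (SplitIdx k d') → (SplitIdx k d' → ZMod N') → ℝ)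
    (pp : (SplitIdx k d' → ZMod N') × (SplitIdx k d' → ZMod N')) : ℝ :=
  ∏ C ∈ (privSet k d').ssubsets, ∏ ω ∈ C.powerset, ν C (mixPt pp.1 pp.2 ω)

/-- The fibre coordinates `r = (u, y⁰, y¹)`: `u` carries the private coordinates of `x⁽⁰⁾` other
than the pivot (its pivot coordinate is ignored), `y⁰` the undoubled coordinates, `y¹` the
(irrelevant) second copy of the undoubled coordinates.
[cite: GreenTao2010, App. C (the variables of `W(z,h)`)] -/
abbrev FibreCoords (N' k d' : ℕ) := (Fin k → ZMod N') × (Fin d' → ZMod N') × (Fin d' → ZMod N')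

variable (hk : 1 ≤ k)

/-- The pivot private coordinate. [folklore] -/
def pivot (hk : 1 ≤ k) : Fin k := ⟨0, hk⟩

/-- The private coordinates `x⁽⁰⁾` on the fibre over `z`: solve `b₀(y⁰) + ∑ a_j x_j = z` for the
pivot coordinate. [cite: GreenTao2010, App. C (substituting for `x_{s+1}^{(0)}`)] -/
def fibrePoint (a : Fin k → ZMod N') (ainv : ZMod N') (b₀ : (Fin d' → ZMod N') → ZMod N')
    (z : ZMod N') (r : FibreCoords N' k d') : Fin k → ZMod N' :=
  Function.update r.1 (pivot hk)
    (ainv * (z - b₀ r.2.1 - ∑ j ∈ Finset.univ.erase (pivot hk), a j * r.1 j))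

/-- The parametrisation `(z, h, r) ↦ (x⁽⁰⁾ ⊕ y⁰, (x⁽⁰⁾ + h) ⊕ y¹)` of pairs of points by the value
`z` of the distinguished form, the difference `h` of the private coordinates and the fibre
coordinates. [cite: GreenTao2010, App. C (the substitution `h := x⁽¹⁾ - x⁽⁰⁾`, `z := …`)] -/
def topParam (a : Fin k → ZMod N') (ainv : ZMod N') (b₀ : (Fin d' → ZMod N') → ZMod N')
    (q : ZMod N' × (Fin k → ZMod N')) (r : FibreCoords N' k d') :
    (SplitIdx k d' → ZMod N') × (SplitIdx k d' → ZMod N') :=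
  (Sum.elim (fibrePoint hk a ainv b₀ q.1 r) r.2.1, Sum.elim (fibrePoint hk a ainv b₀ q.1 r + q.2) r.2.2)

omit [NeZero N'] in
/-- The value of the distinguished form at the fibre point is `z`. [folklore] -/
theorem topForm_fibrePoint (a : Fin k → ZMod N') {ainv : ZMod N'} (hainv : a (pivot hk) * ainv = 1)
    (b₀ : (Fin d' → ZMod N') → ZMod N') (z : ZMod N') (r : FibreCoords N' k d') :
    b₀ r.2.1 + ∑ j, a j * fibrePoint hk a ainv b₀ z r j = z := by
  unfold fibrePoint
  rw [← Finset.add_sum_erase _ _ (Finset.mem_univ (pivot hk)), Function.update_self]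
  have : ∑ j ∈ Finset.univ.erase (pivot hk), a j * Function.update r.1 (pivot hk)
      (ainv * (z - b₀ r.2.1 - ∑ j ∈ Finset.univ.erase (pivot hk), a j * r.1 j)) j =
      ∑ j ∈ Finset.univ.erase (pivot hk), a j * r.1 j :=
    Finset.sum_congr rfl fun j hj => by rw [Function.update_of_ne (Finset.ne_of_mem_erase hj)]
  rw [this]
  linear_combination (z - b₀ r.2.1 - ∑ j ∈ Finset.univ.erase (pivot hk), a j * r.1 j) * hainv

/-- **The parametrisation is uniform**: remembering the discarded pivot coordinate of `u` makes
`(z, h, r) ↦ (topParam, u_{pivot})` a bijection onto (pairs of points) `× ℤ_{N'}`.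
[cite: GreenTao2010, App. C ("each `z` is mapped to by exactly `(N')^{d-1}` preimages")] -/
def topParamEquiv (a : Fin k → ZMod N') {ainv : ZMod N'} (hainv : a (pivot hk) * ainv = 1)
    (b₀ : (Fin d' → ZMod N') → ZMod N') :
    ((ZMod N' × (Fin k → ZMod N')) × FibreCoords N' k d') ≃
      (((SplitIdx k d' → ZMod N') × (SplitIdx k d' → ZMod N')) × ZMod N') where
  toFun qr := (topParam hk a ainv b₀ qr.1 qr.2, qr.2.1 (pivot hk))
  invFun pw :=
    ((topForm a b₀ pw.1.1, fun j => pw.1.2 (Sum.inl j) - pw.1.1 (Sum.inl j)),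
      (Function.update (fun j => pw.1.1 (Sum.inl j)) (pivot hk) pw.2,
        fun m => pw.1.1 (Sum.inr m), fun m => pw.1.2 (Sum.inr m)))
  left_inv qr := by
    obtain ⟨⟨z, h⟩, u, y₀, y₁⟩ := qr
    have hfp : topForm a b₀ (Sum.elim (fibrePoint hk a ainv b₀ z (u, y₀, y₁)) y₀) = z := by
      unfold topForm
      simp only [Sum.elim_inr, Sum.elim_inl]
      exact topForm_fibrePoint hk a hainv b₀ z (u, y₀, y₁)
    simp only [topParam, hfp, Sum.elim_inl, Sum.elim_inr, Pi.add_apply, add_sub_cancel_left]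
    refine Prod.ext rfl (Prod.ext ?_ (Prod.ext rfl rfl))
    simp only [fibrePoint, Function.update_idem, Function.update_eq_self]
  right_inv pw := by
    obtain ⟨⟨p₀, p₁⟩, w⟩ := pw
    have hainv' : ainv * a (pivot hk) = 1 := by rw [mul_comm]; exact hainv
    -- the fibre point recovers the private coordinates of `p₀`
    have hfp : fibrePoint hk a ainv b₀ (topForm a b₀ p₀)
        (Function.update (fun j => p₀ (Sum.inl j)) (pivot hk) w,
          fun m => p₀ (Sum.inr m), fun m => p₁ (Sum.inr m)) = fun j => p₀ (Sum.inl j) := by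
      unfold fibrePoint topForm
      simp only [Function.update_idem]
      have hsum : ∑ j ∈ Finset.univ.erase (pivot hk),
          a j * Function.update (fun j => p₀ (Sum.inl j)) (pivot hk) w j =
          ∑ j ∈ Finset.univ.erase (pivot hk), a j * p₀ (Sum.inl j) :=
        Finset.sum_congr rfl fun j hj => by rw [Function.update_of_ne (Finset.ne_of_mem_erase hj)]
      rw [hsum, ← Finset.add_sum_erase _ _ (Finset.mem_univ (pivot hk))]
      have : ainv * (b₀ (fun m => p₀ (Sum.inr m)) + (a (pivot hk) * p₀ (Sum.inl (pivot hk)) +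
          ∑ j ∈ Finset.univ.erase (pivot hk), a j * p₀ (Sum.inl j)) - b₀ (fun m => p₀ (Sum.inr m)) -
          ∑ j ∈ Finset.univ.erase (pivot hk), a j * p₀ (Sum.inl j)) = p₀ (Sum.inl (pivot hk)) := by
        linear_combination p₀ (Sum.inl (pivot hk)) * hainv'
      rw [this]
      exact Function.update_eq_self _ _
    simp only [topParam, hfp]
    refine Prod.ext (Prod.ext ?_ ?_) ?_
    · funext i; cases i <;> simp
    · funext i; cases i <;> simp
    · simp

/-- **Change of variables** `(x⁽⁰⁾, y⁰, x⁽¹⁾, y¹) ↔ (z, h, r)`: averages over pairs of points are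
averages over `(z, h)` of averages over the fibre coordinates.
[cite: GreenTao2010, App. C ("Thus we may rewrite the preceding expression as
`𝔼_{z ∈ ℤ_{N'}, h} W(z,h) ∏_ω f₁(z + ∑ ω_j h_j)`")] -/
theorem expect_pairs_eq_expect_topParam (a : Fin k → ZMod N') {ainv : ZMod N'}
    (hainv : a (pivot hk) * ainv = 1) (b₀ : (Fin d' → ZMod N') → ZMod N')
    (F : (SplitIdx k d' → ZMod N') × (SplitIdx k d' → ZMod N') → ℝ) :
    𝔼 pp, F pp = 𝔼 q : ZMod N' × (Fin k → ZMod N'), 𝔼 r : FibreCoords N' k d',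
      F (topParam hk a ainv b₀ q r) := by
  rw [expect_expect_eq_expect_prod (fun (q : ZMod N' × (Fin k → ZMod N')) (r : FibreCoords N' k d') =>
    F (topParam hk a ainv b₀ q r))]
  have h := expect_comp_equiv (topParamEquiv hk a hainv b₀)
    (fun pw : ((SplitIdx k d' → ZMod N') × (SplitIdx k d' → ZMod N')) × ZMod N' => F pw.1)
  rw [expect_prod_fst] at h
  exact h.symm

/-- Products over the vertices `ω ⊆ A` of the private cube are products over `{0,1}^k`.
[folklore] -/
theorem prod_powerset_privSet (F : Finset (SplitIdx k d') → ℝ) :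
    ∏ ω ∈ (privSet k d').powerset, F ω =
      ∏ ω' : Finset (Fin k), F (ω'.map ⟨Sum.inl, Sum.inl_injective⟩) := by
  rw [← Finset.powerset_univ]
  symm
  refine Finset.prod_nbij' (fun ω' => ω'.map ⟨Sum.inl, Sum.inl_injective⟩)
    (fun ω => Finset.univ.filter fun j => Sum.inl j ∈ ω) ?_ ?_ ?_ ?_ ?_
  · intro ω' _
    exact Finset.mem_powerset.mpr (Finset.map_subset_map.mpr (Finset.subset_univ _))
  · intro ω _; exact Finset.mem_powerset.mpr (Finset.subset_univ _)
  · intro ω' _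
    ext j; simp
  · intro ω hω
    have hω' := Finset.mem_powerset.mp hω
    ext i
    simp only [Finset.mem_map, Finset.mem_filter, Finset.mem_univ, true_and,
      Function.Embedding.coeFn_mk]
    constructor
    · rintro ⟨j, hj, rfl⟩; exact hj
    · intro hi
      obtain ⟨j, _, rfl⟩ := Finset.mem_map.mp (hω' hi)
      exact ⟨j, hi, rfl⟩
  · intro ω' _; rfl

omit [NeZero N'] in
/-- The distinguished form at the vertices of the parametrised cube:
`θ₀(x^{(ω)}) = z + ∑_{j ∈ ω} a_j h_j`. [cite: GreenTao2010, App. C (`f₁(z + ∑ ω_j h_j)`)] -/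
theorem topForm_mixPt_topParam (a : Fin k → ZMod N') {ainv : ZMod N'}
    (hainv : a (pivot hk) * ainv = 1) (b₀ : (Fin d' → ZMod N') → ZMod N')
    (q : ZMod N' × (Fin k → ZMod N')) (r : FibreCoords N' k d') (ω' : Finset (Fin k)) :
    topForm a b₀ (mixPt (topParam hk a ainv b₀ q r).1 (topParam hk a ainv b₀ q r).2
      (ω'.map ⟨Sum.inl, Sum.inl_injective⟩)) = q.1 + ∑ j ∈ ω', a j * q.2 j := by
  unfold topForm topParam
  have hy : (fun m => mixPt (Sum.elim (fibrePoint hk a ainv b₀ q.1 r) r.2.1)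
      (Sum.elim (fibrePoint hk a ainv b₀ q.1 r + q.2) r.2.2)
      (ω'.map ⟨Sum.inl, Sum.inl_injective⟩) (Sum.inr m)) = r.2.1 := by
    funext m
    rw [mixPt_of_not_mem (by simp)]
    rfl
  have hx : ∀ j, mixPt (Sum.elim (fibrePoint hk a ainv b₀ q.1 r) r.2.1)
      (Sum.elim (fibrePoint hk a ainv b₀ q.1 r + q.2) r.2.2)
      (ω'.map ⟨Sum.inl, Sum.inl_injective⟩) (Sum.inl j) =
      fibrePoint hk a ainv b₀ q.1 r j + if j ∈ ω' then q.2 j else 0 := by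
    intro j
    by_cases hj : j ∈ ω'
    · rw [mixPt_of_mem (show Sum.inl j ∈ ω'.map ⟨Sum.inl, Sum.inl_injective⟩ from
        Finset.mem_map.mpr ⟨j, hj, rfl⟩), if_pos hj]; rfl
    · rw [mixPt_of_not_mem (by simpa using hj), if_neg hj, add_zero]; rfl
  rw [hy]
  simp_rw [hx, mul_add, Finset.sum_add_distrib]
  rw [← add_assoc, topForm_fibrePoint hk a hainv b₀ q.1 r]
  congr 1
  rw [← Finset.sum_filter_add_sum_filter_not Finset.univ (fun j => j ∈ ω')]
  have h1 : Finset.univ.filter (fun j => j ∈ ω') = ω' := by ext j; simp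
  rw [h1]
  have h2 : ∑ j ∈ Finset.univ.filter (fun j => ¬ j ∈ ω'), a j * (if j ∈ ω' then q.2 j else 0) = 0 :=
    Finset.sum_eq_zero fun j hj => by rw [if_neg (Finset.mem_filter.mp hj).2, mul_zero]
  rw [h2, add_zero]
  exact Finset.sum_congr rfl fun j hj => by rw [if_pos hj]

end topterm


section topbound

variable {N' : ℕ} [NeZero N'] {k d' : ℕ} (hk : 1 ≤ k)

/-- The majorant of the Gowers product of the distinguished function:
`V(z, h) = ∏_ω ν̄(z + ∑_{j ∈ ω} a_j h_j)`. [cite: GreenTao2010, App. C (the hypothesis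
`|f₁(x)| ≤ ν(x)` in the final Cauchy–Schwarz)] -/
def topV (ν₀ : ZMod N' → ℝ) (a : Fin k → ZMod N') (q : ZMod N' × (Fin k → ZMod N')) : ℝ :=
  gowersProd k ν₀ q.1 (fun j => a j * q.2 j)

/-- `A₀ = 𝔼_{z,h} V(z,h)` (`= ‖ν̄‖_{U^k}^{2^k}`): the `n = 0` average of App. C.
[cite: GreenTao2010, App. C (the estimates "for `n = 0, 1, 2`")] -/
def topA₀ (ν₀ : ZMod N' → ℝ) (a : Fin k → ZMod N') : ℝ :=
  𝔼 q : ZMod N' × (Fin k → ZMod N'), topV ν₀ a q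

/-- `A₁ = 𝔼_{z,h} V(z,h) W(z,h)` written over free variables: the `n = 1` average of App. C.
[cite: GreenTao2010, App. C (the estimates "for `n = 0, 1, 2`")] -/
def topA₁ (ν₀ : ZMod N' → ℝ) (a : Fin k → ZMod N') (ainv : ZMod N')
    (b₀ : (Fin d' → ZMod N') → ZMod N')
    (ν : Finset (SplitIdx k d') → (SplitIdx k d' → ZMod N') → ℝ) : ℝ :=
  𝔼 q : ZMod N' × (Fin k → ZMod N'), 𝔼 r : FibreCoords N' k d',
    topV ν₀ a q * topWeight ν (topParam hk a ainv b₀ q r)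

/-- `A₂ = 𝔼_{z,h} V(z,h) W(z,h)²` written over free variables (two independent copies of the
fibre coordinates): the `n = 2` average of App. C.
[cite: GreenTao2010, App. C ("the average `𝔼_*` is over all sextuples")] -/
def topA₂ (ν₀ : ZMod N' → ℝ) (a : Fin k → ZMod N') (ainv : ZMod N')
    (b₀ : (Fin d' → ZMod N') → ZMod N')
    (ν : Finset (SplitIdx k d') → (SplitIdx k d' → ZMod N') → ℝ) : ℝ :=
  𝔼 q : ZMod N' × (Fin k → ZMod N'), 𝔼 r : FibreCoords N' k d', 𝔼 r' : FibreCoords N' k d',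
    topV ν₀ a q * topWeight ν (topParam hk a ainv b₀ q r) * topWeight ν (topParam hk a ainv b₀ q r')

omit [NeZero N'] in
/-- `|∏_ω g₀| ≤ ∏_ω ν̄` for `|g₀| ≤ ν̄`. [folklore] -/
theorem abs_gowersProd_le {g₀ ν₀ : ZMod N' → ℝ} (hg : ∀ x, |g₀ x| ≤ ν₀ x) (z : ZMod N')
    (h : Fin k → ZMod N') : |gowersProd k g₀ z h| ≤ gowersProd k ν₀ z h := by
  unfold gowersProd
  rw [Finset.abs_prod]
  exact Finset.prod_le_prod (fun _ _ => abs_nonneg _) fun _ _ => hg _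

/-- The weighted box power of a function of the distinguished form through `(z, h, r)`:
`‖g ∘ θ₀‖_{□^A(ν)}^{2^k} = 𝔼_{z,h} (∏_ω g(z + ∑_{j∈ω} a_j h_j)) W(z,h)` with
`W(z,h) = 𝔼_r (lower weight)`. [cite: GreenTao2010, App. C ("Thus we may rewrite the preceding
expression as `𝔼_{z,h} W(z,h) ∏_ω f₁(z + ∑ ω_j h_j)`")] -/
theorem wBoxPower_top_eq {a : Fin k → ZMod N'} {ainv : ZMod N'} (hainv : a (pivot hk) * ainv = 1)
    (b₀ : (Fin d' → ZMod N') → ZMod N') (g : ZMod N' → ℝ)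
    (ν : Finset (SplitIdx k d') → (SplitIdx k d' → ZMod N') → ℝ) :
    wBoxPower ν (privSet k d') (fun p => g (topForm a b₀ p)) =
      𝔼 q : ZMod N' × (Fin k → ZMod N'), gowersProd k g q.1 (fun j => a j * q.2 j) *
        𝔼 r : FibreCoords N' k d', topWeight ν (topParam hk a ainv b₀ q r) := by
  unfold wBoxPower
  rw [expect_pairs_eq_expect_topParam hk a hainv b₀]
  refine Finset.expect_congr rfl fun q _ => ?_
  rw [Finset.mul_expect]
  refine Finset.expect_congr rfl fun r _ => ?_
  congr 1
  rw [prod_powerset_privSet]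
  simp_rw [topForm_mixPt_topParam hk a hainv b₀]
  rfl

/-- `A₁` is the weighted box power of the majorant of the distinguished form.
[cite: GreenTao2010, App. C (the case `n = 1`)] -/
theorem topA₁_eq_wBoxPower {a : Fin k → ZMod N'} {ainv : ZMod N'} (hainv : a (pivot hk) * ainv = 1)
    (b₀ : (Fin d' → ZMod N') → ZMod N') (ν₀ : ZMod N' → ℝ)
    (ν : Finset (SplitIdx k d') → (SplitIdx k d' → ZMod N') → ℝ) :
    topA₁ hk ν₀ a ainv b₀ ν = wBoxPower ν (privSet k d') (fun p => ν₀ (topForm a b₀ p)) := by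
  rw [wBoxPower_top_eq hk hainv]
  unfold topA₁ topV
  refine Finset.expect_congr rfl fun q _ => ?_
  rw [Finset.mul_expect]

/-- **The top term** (the top-term estimate of App. C and "Comparing this with [the definition of
`U^{s+1}`] … By Cauchy–Schwarz and the hypothesis `|f₁(x)| ≤ ν(x)`"): for units `a_j`, `|g₀| ≤ ν̄`, `ν ≥ 0`,
`‖g₀ ∘ θ₀‖_{□^A(ν)}^{2^k} ≤ ‖g₀‖_{U^k(ℤ_{N'})}^{2^k} + (A₀ |A₂ - 2 A₁ + A₀|)^{1/2}`, where
`‖g₀ ∘ θ₀‖_{□^A(ν)}^{2^k} = 𝔼_{z,h} W(z,h) ∏_ω g₀(z + ∑_{j∈ω} a_j h_j)` and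
`𝔼 V (W-1)² = A₂ - 2A₁ + A₀`. [cite: GreenTao2010, App. C (proof of the top-term estimate)] -/
theorem wBoxPower_top_le {a : Fin k → ZMod N'} (ha : ∀ j, IsUnit (a j)) {ainv : ZMod N'}
    (hainv : a (pivot hk) * ainv = 1) (b₀ : (Fin d' → ZMod N') → ZMod N')
    {g₀ ν₀ : ZMod N' → ℝ} (hg : ∀ x, |g₀ x| ≤ ν₀ x)
    (ν : Finset (SplitIdx k d') → (SplitIdx k d' → ZMod N') → ℝ) (hν : ∀ C p, 0 ≤ ν C p) :
    wBoxPower ν (privSet k d') (fun p => g₀ (topForm a b₀ p)) ≤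
      gowersPower k g₀ + Real.sqrt (topA₀ ν₀ a *
        |topA₂ hk ν₀ a ainv b₀ ν - 2 * topA₁ hk ν₀ a ainv b₀ ν + topA₀ ν₀ a|) := by
  -- notation
  set Φ' : ZMod N' × (Fin k → ZMod N') → ℝ := fun q => gowersProd k g₀ q.1 (fun j => a j * q.2 j)
    with hΦ'
  set W : ZMod N' × (Fin k → ZMod N') → ℝ :=
    fun q => 𝔼 r : FibreCoords N' k d', topWeight ν (topParam hk a ainv b₀ q r) with hW
  set V : ZMod N' × (Fin k → ZMod N') → ℝ := topV ν₀ a with hV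
  have hVnn : ∀ q, 0 ≤ V q := fun q =>
    (abs_nonneg _).trans (abs_gowersProd_le hg q.1 _)
  have hWt_nn : ∀ pp, 0 ≤ topWeight ν pp := fun pp =>
    Finset.prod_nonneg fun C _ => Finset.prod_nonneg fun ω _ => hν _ _
  -- Step 1–2: the weighted box power through `(z, h, r)`
  have hbox : wBoxPower ν (privSet k d') (fun p => g₀ (topForm a b₀ p)) = 𝔼 q, Φ' q * W q :=
    wBoxPower_top_eq hk hainv b₀ g₀ ν
  -- Step 3: the main term
  have hmain : 𝔼 q, Φ' q = gowersPower k g₀ := by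
    rw [hΦ', expect_prod_eq]
    unfold gowersPower
    rw [expect_prod_eq]
    refine Finset.expect_congr rfl fun z _ => ?_
    exact expect_pi_unit_mul (fun h => gowersProd k g₀ z h) ha
  -- Step 4: Cauchy–Schwarz
  have hΦV : ∀ q, |Φ' q| ≤ V q := fun q => abs_gowersProd_le hg q.1 _
  have hcs : |𝔼 q, Φ' q * (W q - 1)| ≤
      Real.sqrt ((𝔼 q, V q) * 𝔼 q, V q * (W q - 1) ^ 2) := by
    have h1 : |𝔼 q, Φ' q * (W q - 1)| ≤ 𝔼 q, V q * |W q - 1| :=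
      (Finset.abs_expect_le _ _).trans (Finset.expect_le_expect fun q _ => by
        rw [abs_mul]; exact mul_le_mul_of_nonneg_right (hΦV q) (abs_nonneg _))
    refine h1.trans ?_
    have h2 := Finset.expect_mul_sq_le_sq_mul_sq Finset.univ (fun q => Real.sqrt (V q))
      (fun q => Real.sqrt (V q) * |W q - 1|)
    have h3 : ∀ q, Real.sqrt (V q) * (Real.sqrt (V q) * |W q - 1|) = V q * |W q - 1| := fun q => by
      rw [← mul_assoc, Real.mul_self_sqrt (hVnn q)]
    have h4 : ∀ q, (Real.sqrt (V q) * |W q - 1|) ^ 2 = V q * (W q - 1) ^ 2 := fun q => by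
      rw [mul_pow, Real.sq_sqrt (hVnn q), sq_abs]
    simp_rw [h3, Real.sq_sqrt (hVnn _), h4] at h2
    have h5 : 0 ≤ 𝔼 q, V q * |W q - 1| :=
      Finset.expect_nonneg fun q _ => mul_nonneg (hVnn q) (abs_nonneg _)
    rw [← abs_of_nonneg h5]
    exact Real.abs_le_sqrt h2
  -- Step 5: `𝔼 V (W-1)² = A₂ - 2A₁ + A₀`
  have hexp : 𝔼 q, V q * (W q - 1) ^ 2 =
      topA₂ hk ν₀ a ainv b₀ ν - 2 * topA₁ hk ν₀ a ainv b₀ ν + topA₀ ν₀ a := by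
    have : ∀ q, V q * (W q - 1) ^ 2 = V q * W q * W q - 2 * (V q * W q) + V q := fun q => by ring
    simp_rw [this]
    rw [Finset.expect_add_distrib, Finset.expect_sub_distrib]
    congr 1
    congr 1
    · unfold topA₂
      refine Finset.expect_congr rfl fun q _ => ?_
      rw [mul_assoc, hW, Fintype.expect_mul_expect, Finset.mul_expect]
      refine Finset.expect_congr rfl fun r _ => ?_
      rw [Finset.mul_expect]
      refine Finset.expect_congr rfl fun r' _ => ?_
      ring
    · rw [← Finset.mul_expect]
      unfold topA₁
      congr 1
      refine Finset.expect_congr rfl fun q _ => ?_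
      rw [hW, Finset.mul_expect]
  -- Step 6: assemble
  have hA₀ : 0 ≤ topA₀ ν₀ a := Finset.expect_nonneg fun q _ => hVnn q
  have hsplit : 𝔼 q, Φ' q * W q = (𝔼 q, Φ' q) + 𝔼 q, Φ' q * (W q - 1) := by
    rw [← Finset.expect_add_distrib]
    exact Finset.expect_congr rfl fun q _ => by ring
  rw [hbox, hsplit, hmain]
  refine add_le_add (le_refl _) ((le_abs_self _).trans (hcs.trans (Real.sqrt_le_sqrt ?_)))
  rw [hexp]
  exact mul_le_mul_of_nonneg_left (le_abs_self _) hA₀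

/-- The private coordinate set has `k` elements. [folklore] -/
theorem card_privSet : (privSet k d').card = k := by
  simp [privSet]

/-- **The reduced generalised von Neumann inequality, core form** (Green–Tao 2010, App. C,
"Proposition 7.1″" through the top-term and lower-weight estimates, with the lower-order
functions abstract): in split
coordinates, for families `f_B, ν_B` (`B ⊆ A` = the private coordinates) with `|f_B| ≤ ν_B`,
each depending only on `x_B` and `y`, with top function `f_A = g₀ ∘ θ₀` and `|g₀| ≤ ν̄`,
`|𝔼 ∏_{B ⊆ A} f_B|^{2^k} ≤ (‖g₀‖_{U^k}^{2^k} + (A₀ |A₂ - 2A₁ + A₀|)^{1/2}) ∏_{B ⊊ A} ‖ν_B‖_{□^B(ν)}^{2^{|B|}}`.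
The remaining averages `A₀, A₁, A₂` and `‖ν_B‖_{□^B(ν)}^{2^{|B|}}` are `1 + o(1)` by the linear forms
condition (the lower-weight estimate, and "This will follow from the linear forms condition").
[cite: GreenTao2010, App. C (Main argument)] -/
theorem coreGvN {a : Fin k → ZMod N'} (ha : ∀ j, IsUnit (a j)) {ainv : ZMod N'}
    (hainv : a (pivot hk) * ainv = 1) (b₀ : (Fin d' → ZMod N') → ZMod N')
    {g₀ ν₀ : ZMod N' → ℝ} (hg : ∀ x, |g₀ x| ≤ ν₀ x)
    (f ν : Finset (SplitIdx k d') → (SplitIdx k d' → ZMod N') → ℝ)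
    (hfA : f (privSet k d') = fun p => g₀ (topForm a b₀ p))
    (hf : ∀ B, B ⊆ privSet k d' → DependsOn (f B) ((↑B : Set (SplitIdx k d')) ∪ (↑(privSet k d'))ᶜ))
    (hν : ∀ B, B ⊆ privSet k d' → DependsOn (ν B) ((↑B : Set (SplitIdx k d')) ∪ (↑(privSet k d'))ᶜ))
    (hνnn : ∀ B p, 0 ≤ ν B p) (hdom : ∀ B, B ⊆ privSet k d' → ∀ p, |f B p| ≤ ν B p) :
    |𝔼 p, ∏ B ∈ (privSet k d').powerset, f B p| ^ (2 ^ k) ≤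
      (gowersPower k g₀ + Real.sqrt (topA₀ ν₀ a *
        |topA₂ hk ν₀ a ainv b₀ ν - 2 * topA₁ hk ν₀ a ainv b₀ ν + topA₀ ν₀ a|)) *
        ∏ B ∈ (privSet k d').ssubsets, wBoxPower ν B (ν B) := by
  have hA : (privSet k d').Nonempty := ⟨Sum.inl (pivot hk), by simp [privSet]⟩
  have h1 := weightedGvN hA f ν hf hν (fun B _ p => hνnn B p) hdom
  rw [card_privSet] at h1
  refine h1.trans (mul_le_mul_of_nonneg_right ?_ (Finset.prod_nonneg fun B _ =>
    Finset.expect_nonneg fun pp _ => mul_nonneg (Finset.prod_nonneg fun _ _ => hνnn _ _)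
      (Finset.prod_nonneg fun _ _ => Finset.prod_nonneg fun _ _ => hνnn _ _)))
  rw [hfA]
  exact wBoxPower_top_le hk ha hainv b₀ hg ν hνnn

end topbound


end Literature.NumberTheory.Sieve
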